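import Summits.Langlands.Langlands.Theorems.IrreducibilityBySelfDualityPairLBoundaryJS
import Summits.Langlands.Langlands.Theorems.IrreducibilityBySelfDualityPairLBoundaryJSSsv
import Summits.Langlands.Langlands.Theorems.IrreducibilityBySelfDualityPairLBoundaryJSStandardEntire
import Summits.Langlands.Langlands.Theorems.IrreducibilityBySelfDualityPairLBoundaryJSIsOrthoOfLocalTranslate
import Summits.Langlands.Langlands.Theorems.IrreducibilityBySelfDualityPairLBoundaryJSEqConjOfLocalTranslate
import Summits.Langlands.Langlands.Theorems.IrreducibilityBySelfDualityPairLBoundaryJSLocalPairTranslate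
import Summits.Langlands.Langlands.Theorems.IrreducibilityBySelfDualityPairLBoundaryJSOfHumphriesJo
import Summits.Langlands.Langlands.Theorems.IrreducibilityBySelfDualityPairLBoundaryJSCornerBochnerIwasawa
import Summits.Langlands.Langlands.Theorems.IrreducibilityBySelfDualityPairLBoundaryJSCornerPairTranslate
import Summits.Langlands.Langlands.Theorems.IrreducibilityBySelfDualityPairLBoundaryJSCornerPairEuler
import Summits.Langlands.Langlands.Theorems.IrreducibilityBySelfDualityPairLBoundaryJSCornerAbsMajorant
import Summits.Langlands.Langlands.Theorems.IrreducibilityBySelfDualityPairLBoundaryJSCornerAbsIdeleMoment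
import Summits.Langlands.Langlands.Theorems.IrreducibilityBySelfDualityPairLBoundaryJSCornerAbsTorusMajorant
import Summits.Langlands.Langlands.Theorems.IrreducibilityBySelfDualityPairLBoundaryJSCornerAbsConvergence
import Summits.Langlands.Langlands.Theorems.IrreducibilityBySelfDualityPairLBoundaryJSCornerEulerLimit
import Summits.Langlands.Langlands.Theorems.IrreducibilityBySelfDualityPairLBoundaryJSHonestTranslateUnramified
import Literature.NumberTheory.Automorphic.PairLFunctionMeromorphicContinuationRankNeTwistProofs
import Literature.NumberTheory.Automorphic.ArchRankinSelbergTestVector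
import Literature.NumberTheory.Automorphic.JPSSGlobalIntegralQuotientUnfolding
import Literature.NumberTheory.Automorphic.JPSSCornerWhittakerUnfolding
import Literature.NumberTheory.Automorphic.WhittakerPeriodExchange
import Literature.NumberTheory.Automorphic.TorusIwasawaTransport
import Literature.NumberTheory.Automorphic.CornerTorusIwasawaData
import Literature.NumberTheory.Automorphic.WhittakerCoeffHonestCuspForm
import Literature.NumberTheory.Automorphic.WhittakerCoeffTranslateUnramified
import Literature.NumberTheory.Automorphic.WhittakerDecayCuspForm
import Literature.NumberTheory.Automorphic.WhittakerSupportFinite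
import Literature.NumberTheory.Automorphic.RatPointsCoveringWeights
import Literature.NumberTheory.Automorphic.WhittakerTowerDerivative
import Literature.NumberTheory.Automorphic.WhittakerTowerEquivariance
import Literature.NumberTheory.Automorphic.CuspFormsBoundedHC

/-!
# The global corner theorem: the `GL_{m+1} × GL_m` integral `I(s; φ, φ')` unfolded to the torus

Summit `Langlands`, sub-problem `Langlands`, helper file under `Theorems/` supporting the crux
`PairLBoundaryJS` (stmt-Langlands-13622), line `Sketch`, registered stub `stub_corner_global` (W-G):
for `0 < m`, an automorphic measure `μ'` on `X_m` and Haar measures `νA`, `νK` on the torus coordinates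
there is `C > 0` such that for all honest cusp forms `φ` on `X_{m+1}`, `φ'` on `X_m` (`Φ = invQuot φ`,
`Φ' = invQuot φ'`) and every `s` at which `∫ |W_Φ(ι(a k))| |det a|^{re s-1/2} δ_B(a)⁻¹ d(νA ⊗ νK) < ∞`,

  `I(s; φ, φ') = C ∫_{(𝔸ˣ)ᵐ × K} W_Φ(ι(a k)) conj (W_{Φ̄'}(a k)) |det a|^{s-1/2} δ_B(a)⁻¹ d(νA ⊗ νK)`

(`W = whittakerDepth 0`, `ι = glCorner = diag(·, 1)`; Cogdell (2004), §2.2–2.3, Thm. 2.1, Eulerian clause;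
Jacquet–Piatetski-Shapiro–Shalika (1983), §2). The ASSEMBLY of the tree's proved bricks
`exists_jpssIntegral_eq_mul_integral_coveringWeight` (quotient → group, `GL_m(K)`-covering weight),
`integral_whittakerDepth_glCorner_mul_eq` (Fourier–Whittaker expansion along the corner, `GL_m(K) ⊇ N_m(K)`),
`integral_mul_mul_toReal_eq_integral_mul_conj_whittakerDepth` (`Φ' ↦ conj W_{Φ̄'}`; the factor
`W_Φ(ι x) |det x|^{s-1/2}` is `(N_m(𝔸), ψ)`-equivariant since `ψ_{N_{m+1}}(ι u) = ψ_{N_m}(u)`,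
`CornerGlobal.whittakerDepth_zero_glCorner_colRange_mul`) and `CornerBochnerIwasawa.stub_bochner_iwasawa`
(group → torus; `W_Φ(ι ·) conj W_{Φ̄'}` is `N_m(𝔸)`-invariant as `|ψ_N| = 1`). The bricks' finiteness
hypotheses follow from the torus hypothesis: `Φ'`, `W_{Φ̄'}` are bounded (`IsCuspFormGL.bounded_of_center'`,
`norm_whittakerDepth_le`) and `∫_G |W_Φ(ι x)| |det x|^{re s-1/2} β'(x) dν` is `C_ι` times the torus integral
(`exists_lintegral_mul_rpow_mul_weight_eq_mul_lintegral_prod`).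

## References

* J. W. Cogdell, *Analytic theory of L-functions for GL_n*, in *An Introduction to the Langlands
  Program* (2004), §2.2–2.3, Thm. 2.1 [CogdellAnalyticTheory2004].
* H. Jacquet, I. I. Piatetski-Shapiro, J. Shalika, *Rankin–Selberg convolutions*, Amer. J. Math.
  105 (1983), §2 [JacquetPiatetskiShapiroShalika1983].
-/

noncomputable section

-- `Summit.Langlands.Langlands.…` (summit = sub-problem name, D-0017 layout) trips `dupNamespace`
set_option linter.dupNamespace false

open scoped MatrixGroups Topology Pointwise ENNReal NNReal ComplexConjugate InnerProductSpace ContDiff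
-- the place subtypes indexing `mixedSpace K` are `Fintype` classically (`NormedCommRing (mixedSpace K)`)
open scoped Classical Matrix.Norms.Operator
open NumberField IsDedekindDomain MeasureTheory Measure Matrix Set Filter WithZero
open NumberField.mixedEmbedding
open Literature.NumberTheory.Automorphic AdelicGroupData
open Literature.NumberTheory.GaloisRepresentations (ideleGroup HeckeCharacter)
open Literature.MeasureTheory.Group
open Literature.RingTheory.SymmetricFunctions.SymmPoly
open ValuativeRel

-- the automorphic quotient carries the tree's Borel σ-algebra, not Mathlib's quotient σ-algebra
attribute [-instance] Quotient.instMeasurableSpace QuotientGroup.measurableSpace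

-- the house local instances, exactly as in `RankinSelbergUnfoldingIdentity`
attribute [local instance] adelicBorel borelSpace_adelic locallyCompactSpace_adelic secondCountableTopology_gl_adelic
  glAdeleBorel borelSpace_glAdele borelSpace_ideleGroup secondCountableTopology_ideleGroup

-- Mathlib idiom: the commutator Lie ring on matrices, to mention `(archGroupGL n K).lie`
attribute [local instance 100] LieRing.ofAssociativeRing

namespace Summit.Langlands.Langlands.Theorems.CornerGlobal

/-! ### The corner embedding and the generic character -/

section Corner

variable {m : ℕ} {K : Type} [Field K] [NumberField K]

local notation "𝔸" => AdeleRing (𝓞 K) K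

/-- The superdiagonal sum from the column `1` of the corner `diag(u, 1) ∈ GL_{m+1}` is that of `u` (the
extra entry `(m-1, m)` of `diag(u, 1)` vanishes). [folklore] -/
theorem superdiagSumFrom_one_glCorner {R : Type*} [CommRing R] (u : GL (Fin m) R) :
    superdiagSumFrom 1 ((glCorner R (Nat.le_succ m) u : GL (Fin (m + 1)) R) : Matrix (Fin (m + 1)) (Fin (m + 1)) R) =
      superdiagSumFrom 1 (u : Matrix (Fin m) (Fin m) R) := by
  set M : Matrix (Fin (m + 1)) (Fin (m + 1)) R :=
    ((glCorner R (Nat.le_succ m) u : GL (Fin (m + 1)) R) : Matrix (Fin (m + 1)) (Fin (m + 1)) R) with hM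
  have hlast : ∀ (_ : 1 ≤ ((Fin.last m : Fin (m + 1)) : ℕ) ∧ 0 < ((Fin.last m : Fin (m + 1)) : ℕ))
      (h' : ((Fin.last m : Fin (m + 1)) : ℕ) - 1 < m + 1), M ⟨_, h'⟩ (Fin.last m) = 0 := fun h h' => by
    have hm : 0 < m := by simpa only [Fin.val_last] using h.2
    rw [hM, glCorner_apply_val, dif_pos (by simp only [Fin.val_last]; omega), dif_neg (by simp)]
  have hcast : ∀ (j : Fin m) (h' : ((Fin.castSucc j : Fin (m + 1)) : ℕ) - 1 < m + 1) (h'' : (j : ℕ) - 1 < m),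
      M ⟨_, h'⟩ (Fin.castSucc j) = (u : Matrix (Fin m) (Fin m) R) ⟨_, h''⟩ j := fun j h' h'' => by
    rw [hM, glCorner_apply_val, dif_pos (by simp only [Fin.val_castSucc]; omega), dif_pos (by simp)]
    rfl
  have hsum : ∑ j : Fin m, (if h : 1 ≤ ((Fin.castSucc j : Fin (m + 1)) : ℕ) ∧ 0 < ((Fin.castSucc j : Fin (m + 1)) : ℕ)
      then M ⟨((Fin.castSucc j : Fin (m + 1)) : ℕ) - 1, by have := j.2; simp only [Fin.val_castSucc]; omega⟩
        (Fin.castSucc j) else 0) = ∑ j : Fin m, (if h : 1 ≤ (j : ℕ) ∧ 0 < (j : ℕ) then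
          (u : Matrix (Fin m) (Fin m) R) ⟨(j : ℕ) - 1, by have := j.2; omega⟩ j else 0) := by
    refine Finset.sum_congr rfl fun j _ => ?_
    have hiff : (1 ≤ ((Fin.castSucc j : Fin (m + 1)) : ℕ) ∧ 0 < ((Fin.castSucc j : Fin (m + 1)) : ℕ)) ↔
        (1 ≤ (j : ℕ) ∧ 0 < (j : ℕ)) := by simp only [Fin.val_castSucc]
    by_cases hj : 1 ≤ (j : ℕ) ∧ 0 < (j : ℕ)
    · rw [dif_pos (hiff.2 hj), dif_pos hj, hcast]
    · rw [dif_neg (fun h => hj (hiff.1 h)), dif_neg hj]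
  unfold superdiagSumFrom; rw [Fin.sum_univ_castSucc]
  split_ifs with h
  · rw [hlast h, add_zero, hsum]
  · rw [add_zero, hsum]

/-- **`ψ_{N_{m+1}}(diag(u, 1)) = ψ_{N_m}(u)`**: the generic character restricts along the corner. [folklore] -/
theorem unipotentCharFrom_one_glCorner (u : GL (Fin m) 𝔸) :
    unipotentCharFrom (K := K) 1 (glCorner 𝔸 (Nat.le_succ m) u) = unipotentCharFrom (K := K) 1 u := by
  rw [unipotentCharFrom_apply, unipotentCharFrom_apply, superdiagSumFrom_one_glCorner]

/-- The corner maps `N_m(𝔸_K) = U_{[1,m-1]}(𝔸_K)` into `N_{m+1}(𝔸_K) = U_{[1,m]}(𝔸_K)`. [folklore] -/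
theorem glCorner_mem_adelicColRange {u : GL (Fin m) 𝔸} (hu : u ∈ adelicColRange m K 1 (m - 1)) :
    glCorner 𝔸 (Nat.le_succ m) u ∈ adelicColRange (m + 1) K (0 + 1) (m + 1 - 1) := by
  have hu' : u ∈ upperUnitriangular (Fin m) 𝔸 := by rwa [← unipotentColRange_one_eq_upperUnitriangular]
  have h := glCorner_mem_upperUnitriangular (Nat.le_succ m) hu'
  rwa [← unipotentColRange_one_eq_upperUnitriangular] at h

/-- **`(N_m(𝔸_K), ψ)`-equivariance of `x ↦ W_Φ(diag(x, 1))`** (Cogdell (2004), §1.1, §2.2): for `Φ` on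
`GL_{m+1}(𝔸_K)` left `GL_{m+1}(K)`-invariant, `u ∈ N_m(𝔸_K)` and `x ∈ GL_m(𝔸_K)`,
`W_Φ(diag(u x, 1)) = ψ_N(u) W_Φ(diag(x, 1))` (`W_Φ = whittakerDepth 0 Φ`; `whittakerDepth_colRange_mul` on
`GL_{m+1}` at `diag(u, 1) ∈ N_{m+1}(𝔸_K)`, and `ψ_{N_{m+1}}(diag(u, 1)) = ψ_{N_m}(u)`).
[cite: CogdellAnalyticTheory2004, §1.1] -/
theorem whittakerDepth_zero_glCorner_colRange_mul {Φ : GL (Fin (m + 1)) 𝔸 → ℂ}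
    (hΦK : ∀ (γ₀ : GL (Fin (m + 1)) K) (x : GL (Fin (m + 1)) 𝔸), Φ (ratGL K γ₀ * x) = Φ x)
    {u : GL (Fin m) 𝔸} (hu : u ∈ adelicColRange m K 1 (m - 1)) (x : GL (Fin m) 𝔸) :
    whittakerDepth 0 Φ (glCorner 𝔸 (Nat.le_succ m) (u * x)) =
      (unipotentCharFrom (K := K) 1 u : ℂ) * whittakerDepth 0 Φ (glCorner 𝔸 (Nat.le_succ m) x) := by
  rw [map_mul, whittakerDepth_colRange_mul hΦK (Nat.succ_pos m) (glCorner_mem_adelicColRange hu),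
    unipotentCharFrom_one_glCorner]

/-- `‖a d g‖ ≤ M ‖a‖ r` in `[0, ∞]` when `‖d‖ = r` and `‖g‖ ≤ M`. [folklore] -/
theorem enorm_mul_mul_le {a d g : ℂ} {r M : ℝ} (hd : ‖d‖ = r) (hg : ‖g‖ ≤ M) :
    ‖a * d * g‖ₑ ≤ ENNReal.ofReal M * (‖a‖ₑ * ENNReal.ofReal r) := by
  have hM : 0 ≤ M := (norm_nonneg _).trans hg
  rw [← ofReal_norm, ← ofReal_norm, ← ENNReal.ofReal_mul (norm_nonneg _), ← ENNReal.ofReal_mul hM,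
    norm_mul, norm_mul, hd]
  refine ENNReal.ofReal_le_ofReal ?_
  rw [mul_comm M]
  exact mul_le_mul_of_nonneg_left hg (mul_nonneg (norm_nonneg _) (hd ▸ norm_nonneg _))

end Corner

/-! ### The global corner theorem -/

section Main

variable {m : ℕ} {K : Type} [Field K] [NumberField K]
  [MeasurableSpace (AdeleRing (𝓞 K) K)] [BorelSpace (AdeleRing (𝓞 K) K)]

local notation "𝔸" => AdeleRing (𝓞 K) K

/-- **The global corner theorem** (Cogdell (2004), §2.2–2.3, Thm. 2.1, Eulerian clause, `n = m + 1`;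
Jacquet–Piatetski-Shapiro–Shalika (1983), §2): for `0 < m`, an automorphic measure `μ'` on `X_m` and Haar
measures `νA`, `νK` there is `C > 0` such that for all honest cusp forms `φ` on `X_{m+1}`, `φ'` on `X_m` and
every `s` at which the torus integral of `|W_Φ(ι(a k))| |det a|^{re s - 1/2} δ_B(a)⁻¹` is finite,
`I(s; φ, φ') = C ∫ W_Φ(ι(a k)) conj (W_{Φ̄'}(a k)) |det a|^{s-1/2} δ_B(a)⁻¹ d(νA ⊗ νK)` (the Bochner integral of
`torusPairIntegrandC m K (W_Φ ∘ ι) (conj ∘ W_{Φ̄'}) 1 (s - 1/2)`). [cite: CogdellAnalyticTheory2004, §2.2–2.3 Thm. 2.1] -/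
theorem jpssIntegral_eq_mul_integral_torusPairIntegrandC (hm : 0 < m)
    (μ' : Measure (AdelicGroupData.gl m K).automorphicQuotient) [(AdelicGroupData.gl m K).IsAutomorphicMeasure μ']
    (νA : Measure (Fin m → ideleGroup K)) [IsHaarMeasure νA]
    (νK : Measure ↥(maximalCompactAdelic m K)) [IsHaarMeasure νK] :
    ∃ C : ℝ, 0 < C ∧
      ∀ {φ : (AdelicGroupData.gl (m + 1) K).automorphicQuotient → ℂ},
        IsCuspFormGL (m + 1) K (isCompact_glFiniteIntegralLevel_holds (m + 1) K)
          (invQuot (AdelicGroupData.gl (m + 1) K) φ) →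
      ∀ {φ' : (AdelicGroupData.gl m K).automorphicQuotient → ℂ},
        IsCuspFormGL m K (isCompact_glFiniteIntegralLevel_holds m K) (invQuot (AdelicGroupData.gl m K) φ') →
      ∀ (s : ℂ),
        ∫⁻ p, ‖whittakerDepth 0 (invQuot (AdelicGroupData.gl (m + 1) K) φ)
              (glCorner (AdeleRing (𝓞 K) K) (Nat.le_succ m) (torusPoint m K p))‖ₑ *
            ENNReal.ofReal (torusWeight m K (s.re - 1 / 2) p.1) ∂(νA.prod νK) < ⊤ →
        jpssIntegral (Nat.lt_succ_self m) μ' φ φ' s =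
          (C : ℂ) * ∫ p, torusPairIntegrandC m K
            (fun g => whittakerDepth 0 (invQuot (AdelicGroupData.gl (m + 1) K) φ)
              (glCorner (AdeleRing (𝓞 K) K) (Nat.le_succ m) g))
            (fun g => conj (whittakerDepth 0 (fun x => conj (invQuot (AdelicGroupData.gl m K) φ' x)) g))
            (fun _ => (1 : ℝ)) (s - 1 / 2) p ∂(νA.prod νK) := by
  -- a Haar measure `ν` on `G = GL_m(𝔸_K)`, a Haar measure in both spellings of the Borel structure of `G`
  haveI : T2Space (GL (Fin m) 𝔸) := t2Space_gl m K
  haveI : LocallyCompactSpace (GL (Fin m) 𝔸) := AdelicGroupData.locallyCompactSpace_generalLinearGroup_adeleRing K (Fin m)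
  haveI : SecondCountableTopology (GL (Fin m) 𝔸) := secondCountableTopology_generalLinearGroup_adeleRing K (Fin m)
  set ν : Measure (GL (Fin m) 𝔸) := Measure.haar with hν
  haveI hνH : IsHaarMeasure ν := inferInstance
  haveI : @Measure.IsHaarMeasure (AdelicGroupData.gl m K).Adelic (AdelicGroupData.gl m K).adGroup
      (AdelicGroupData.gl m K).adTop (adelicBorel m K) ν := hνH
  -- the constants of the bricks; a `GL_m(K)`-covering weight `β` and an `N_m(K)`-covering weight `β'`
  obtain ⟨C₂, hC₂, h2⟩ := exists_jpssIntegral_eq_mul_integral_coveringWeight hm (Nat.lt_succ_self m) μ' ν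
  obtain ⟨C₅, hC₅, h5⟩ := CornerBochnerIwasawa.stub_bochner_iwasawa hm ν νA νK
  obtain ⟨Cι, -, hCιtop, hι⟩ := exists_lintegral_mul_rpow_mul_weight_eq_mul_lintegral_prod (K := K) hm ν νA νK
  obtain ⟨β, hβ⟩ := exists_isCoveringWeight_ratPoints (n := m) (K := K) (⊤ : Subgroup (GL (Fin m) K))
  obtain ⟨β', hβ'⟩ := exists_isCoveringWeight_ratPoints (n := m) (K := K) (tailUnipotent m K 0)
  have hβA := hβ; rw [ratPoints_top_eq_arithmeticSubgroup] at hβA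
  refine ⟨C₂ * C₅, mul_pos hC₂ hC₅, fun {φ} hφ {φ'} hφ' s hfin => ?_⟩
  -- the classical functions `Φ`, `Φ'`: continuous, `A_G`-invariant (hence rapidly decreasing, bounded)
  have hΦc : Continuous (invQuot (AdelicGroupData.gl (m + 1) K) φ) := hφ.1.continuous_gl
  have hΦ'c : Continuous (invQuot (AdelicGroupData.gl m K) φ') := hφ'.1.continuous_gl
  have hΦA : ∀ z ∈ (AdelicGroupData.gl (m + 1) K).center', ∀ g : (AdelicGroupData.gl (m + 1) K).Adelic,
      invQuot (AdelicGroupData.gl (m + 1) K) φ (z * g) = invQuot (AdelicGroupData.gl (m + 1) K) φ g :=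
    fun z hz g => invQuot_mul_left _ φ (Subgroup.mem_sup_left hz) g
  have hΦ'A : ∀ z ∈ (AdelicGroupData.gl m K).center', ∀ g : (AdelicGroupData.gl m K).Adelic,
      invQuot (AdelicGroupData.gl m K) φ' (z * g) = invQuot (AdelicGroupData.gl m K) φ' g :=
    fun z hz g => invQuot_mul_left _ φ' (Subgroup.mem_sup_left hz) g
  have hB2 := (h2 φ hΦc (hφ.isRapidlyDecreasingGL_of_center' hΦA) φ' hΦ'c
    (hφ'.isRapidlyDecreasingGL_of_center' hΦ'A) β hβA s).2
  obtain ⟨M, hM⟩ := hφ'.bounded_of_center' hΦ'A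
  set Φ : GL (Fin (m + 1)) 𝔸 → ℂ := invQuot (AdelicGroupData.gl (m + 1) K) φ with hΦdef
  set Φ' : GL (Fin m) 𝔸 → ℂ := invQuot (AdelicGroupData.gl m K) φ' with hΦ'def
  have hΦK : ∀ (γ₀ : GL (Fin (m + 1)) K) (x : GL (Fin (m + 1)) 𝔸), Φ (ratGL K γ₀ * x) = Φ x :=
    fun γ₀ x => hφ.1.leftInvariant _ (show ratGL K γ₀ ∈ rationalPointsGL (m + 1) K from ⟨γ₀, rfl⟩) x
  have hΦ'K : ∀ (γ₀ : GL (Fin m) K) (x : GL (Fin m) 𝔸), Φ' (ratGL K γ₀ * x) = Φ' x :=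
    fun γ₀ x => hφ'.1.leftInvariant _ (show ratGL K γ₀ ∈ rationalPointsGL m K from ⟨γ₀, rfl⟩) x
  -- the Whittaker functions `W = W_Φ` on `GL_{m+1}(𝔸_K)` and `W' = W_{Φ̄'}` on `GL_m(𝔸_K)` (bounded by `M`)
  set W : GL (Fin (m + 1)) 𝔸 → ℂ := whittakerDepth 0 Φ with hWdef
  set W' : GL (Fin m) 𝔸 → ℂ := whittakerDepth 0 (fun x => conj (Φ' x)) with hW'def
  have hW'b : ∀ g : GL (Fin m) 𝔸, ‖conj (W' g)‖ ≤ M := fun g => by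
    rw [Complex.norm_conj]; exact norm_whittakerDepth_le (fun z => by rw [Complex.norm_conj]; exact hM z) 0 g
  have hW'c : Continuous W' := continuous_whittakerDepth (Complex.continuous_conj.comp hΦ'c) 0
  have hWιm : Measurable fun x : GL (Fin m) 𝔸 => W (glCorner 𝔸 (Nat.le_succ m) x) :=
    ((continuous_whittakerDepth hΦc 0).comp (continuous_glCorner _)).measurable
  -- the quasi-character `D = |det|_𝔸^{s - 1/2}` and its modulus `r = |det|_𝔸^{re s - 1/2}`
  set r : GL (Fin m) 𝔸 → ℝ := fun x =>
    ((IdeleClassGroup.ideleNorm K (Matrix.GeneralLinearGroup.det x) : ℝ≥0) : ℝ) ^ (s.re - 1 / 2) with hr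
  set D : GL (Fin m) 𝔸 → ℂ := fun x =>
    ((((IdeleClassGroup.ideleNorm K (Matrix.GeneralLinearGroup.det x) : ℝ≥0) : ℝ) : ℂ)) ^ (s - 1 / 2) with hD
  have hDm : Measurable D := (Complex.measurable_ofReal.comp (measurable_subtype_coe.comp
    ((continuous_ideleNorm_holds K).measurable.comp Matrix.GeneralLinearGroup.continuous_det.measurable))).pow_const _
  have hDn : ∀ x : GL (Fin m) 𝔸, ‖D x‖ = r x := fun x => by
    simp only [hD, hr]
    rw [Complex.norm_cpow_eq_rpow_re_of_pos (ideleNorm_coe_pos K _)]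
    congr 1
    simp [Complex.sub_re]
  have hDu : ∀ u ∈ adelicColRange m K 1 (m - 1), ∀ x : GL (Fin m) 𝔸, D (u * x) = D x := fun u hu x => by
    simp only [hD, map_mul, ideleNorm_det_eq_one_of_mem_adelicColRange hu, one_mul]
  have hDK : ∀ (γ₀ : GL (Fin m) K) (x : GL (Fin m) 𝔸), D (ratGL K γ₀ * x) = D x := fun γ₀ x => by
    have h1 : IdeleClassGroup.ideleNorm K (Matrix.GeneralLinearGroup.det (ratGL K γ₀)) = 1 :=
      ideleNorm_det_toAdelic m K γ₀
    simp only [hD, map_mul, h1, one_mul]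
  -- `(N_m(𝔸), ψ)`-equivariance of `W ∘ ι` and of `W'`; `N_m(K)`-invariance of `Φ'`
  have hWu : ∀ u ∈ adelicColRange m K 1 (m - 1), ∀ x : GL (Fin m) 𝔸, W (glCorner 𝔸 (Nat.le_succ m) (u * x)) =
      (unipotentCharFrom (K := K) 1 u : ℂ) * W (glCorner 𝔸 (Nat.le_succ m) x) :=
    fun u hu x => whittakerDepth_zero_glCorner_colRange_mul hΦK hu x
  have hW'u : ∀ u ∈ adelicColRange m K 1 (m - 1), ∀ x : GL (Fin m) 𝔸,
      W' (u * x) = (unipotentCharFrom (K := K) 1 u : ℂ) * W' x := fun u hu x =>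
    whittakerDepth_colRange_mul (fun γ₀ x => by rw [hΦ'K]) hm (by simpa only [zero_add] using hu) x
  have hΦ'N : ∀ (υ : ↥(rationalColRange m K 1 (m - 1))) (x : GL (Fin m) 𝔸),
      Φ' ((((υ : ↥(adelicColRange m K 1 (m - 1)))) : GL (Fin m) 𝔸) * x) = Φ' x := fun υ x => by
    obtain ⟨γ, hγ⟩ := (mem_rationalColRange_iff (υ : ↥(adelicColRange m K 1 (m - 1)))).1 υ.2
    rw [← hγ]
    exact hΦ'K γ x
  -- the majorant `R(x) = |W(ι x)| |det x|^{re s - 1/2} β'(x)` has finite integral (the `[0, ∞]` Iwasawa form)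
  set R : GL (Fin m) 𝔸 → ℝ≥0∞ := fun x =>
    ‖W (glCorner 𝔸 (Nat.le_succ m) x)‖ₑ * ENNReal.ofReal (r x) * β' x with hR
  have hRL : ∫⁻ x, ENNReal.ofReal M * R x ∂ν < ⊤ := by
    have hF0u : ∀ u ∈ adelicColRange m K 1 (m - 1), ∀ x : GL (Fin m) 𝔸,
        ‖W (glCorner 𝔸 (Nat.le_succ m) (u * x))‖ₑ = ‖W (glCorner 𝔸 (Nat.le_succ m) x)‖ₑ := fun u hu x => by
      rw [hWu u hu x, enorm_mul, ← ofReal_norm (unipotentCharFrom (K := K) 1 u : ℂ), Circle.norm_coe,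
        ENNReal.ofReal_one, one_mul]
    have key := hι hWιm.enorm hF0u (s.re - 1 / 2) hβ'.measurable hβ'.coveringSum_eq
    beta_reduce at key
    rw [lintegral_const_mul' _ _ ENNReal.ofReal_ne_top]
    refine ENNReal.mul_lt_top ENNReal.ofReal_lt_top ?_
    simp only [hR, hr]
    rw [key]
    exact ENNReal.mul_lt_top hCιtop.lt_top hfin
  have hβ'tm : Measurable fun x : GL (Fin m) 𝔸 => (((β' x).toReal : ℝ) : ℂ) :=
    Complex.measurable_ofReal.comp hβ'.measurable.ennreal_toReal
  have hβ'e : ∀ x : GL (Fin m) 𝔸, ‖(((β' x).toReal : ℝ) : ℂ)‖ₑ ≤ β' x := fun x => by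
    rw [← ofReal_norm, Complex.norm_real, Real.norm_eq_abs, abs_of_nonneg ENNReal.toReal_nonneg]
    exact ENNReal.ofReal_toReal_le
  have hdom : ∀ {G : GL (Fin m) 𝔸 → ℂ}, Measurable G → (∀ x, ‖G x‖ ≤ M) →
      Integrable (fun x => W (glCorner 𝔸 (Nat.le_succ m) x) * D x * G x * ((β' x).toReal : ℂ)) ν := by
    intro G hGm hGb
    refine ⟨(((hWιm.mul hDm).mul hGm).mul hβ'tm).aestronglyMeasurable, lt_of_le_of_lt (lintegral_mono fun x => ?_) hRL⟩
    rw [enorm_mul]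
    calc ‖W (glCorner 𝔸 (Nat.le_succ m) x) * D x * G x‖ₑ * ‖(((β' x).toReal : ℝ) : ℂ)‖ₑ
        ≤ ENNReal.ofReal M * (‖W (glCorner 𝔸 (Nat.le_succ m) x)‖ₑ * ENNReal.ofReal (r x)) * β' x :=
          mul_le_mul' (enorm_mul_mul_le (hDn x) (hGb x)) (hβ'e x)
      _ = ENNReal.ofReal M * R x := by simp only [hR]; ring
  -- (B3) the Fourier–Whittaker expansion of `Φ` along the corner, `Θ = Φ' |det|^{s-1/2}`
  set Θ : GL (Fin m) 𝔸 → ℂ := fun x => Φ' x * D x with hΘ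
  have hΘm : Measurable Θ := hΦ'c.measurable.mul hDm
  have hΘK : ∀ (γ₀ : GL (Fin m) K) (x : GL (Fin m) 𝔸), Θ (ratGL K γ₀ * x) = Θ x := fun γ₀ x => by
    simp only [hΘ, hΦ'K, hDK]
  have hint₃ : ∫⁻ x, ‖W (glCorner 𝔸 (Nat.le_succ m) x) * Θ x‖ₑ * β' x ∂ν < ⊤ := by
    refine lt_of_le_of_lt (lintegral_mono fun x => ?_) hRL
    calc ‖W (glCorner 𝔸 (Nat.le_succ m) x) * Θ x‖ₑ * β' x
        = ‖W (glCorner 𝔸 (Nat.le_succ m) x) * D x * Φ' x‖ₑ * β' x := by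
          simp only [hΘ]; rw [mul_comm (Φ' x) (D x), mul_assoc]
      _ ≤ ENNReal.ofReal M * (‖W (glCorner 𝔸 (Nat.le_succ m) x)‖ₑ * ENNReal.ofReal (r x)) * β' x :=
          mul_le_mul' (enorm_mul_mul_le (hDn x) (hM x)) le_rfl
      _ = ENNReal.ofReal M * R x := by simp only [hR]; ring
  have hB3 := integral_whittakerDepth_glCorner_mul_eq ν hφ hΘm hΘK hβ.measurable hβ.coveringSum_eq
    hβ'.measurable hβ'.coveringSum_eq hint₃
  -- (B4) integration over `N_m(K)\N_m(𝔸)` first, `H = W(ι ·) |det|^{s-1/2}`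
  set H : GL (Fin m) 𝔸 → ℂ := fun x => W (glCorner 𝔸 (Nat.le_succ m) x) * D x with hH
  have hHm : Measurable H := hWιm.mul hDm
  have hHu : ∀ (u : ↥(adelicColRange m K 1 (m - 1))) (x : GL (Fin m) 𝔸),
      H ((u : GL (Fin m) 𝔸) * x) = (unipotentCharFrom (K := K) 1 (u : GL (Fin m) 𝔸) : ℂ) * H x := fun u x => by
    simp only [hH]
    rw [hWu _ u.2 x, hDu _ u.2 x, mul_assoc]
  have hB4 := integral_mul_mul_toReal_eq_integral_mul_conj_whittakerDepth hm ν hHm hHu hΦ'c hM hΦ'N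
    hβ'.measurable hβ'.coveringSum_eq (hdom hΦ'c.measurable hM)
  -- (B5) the Iwasawa decomposition, `F = W(ι ·) conj W'` is left `N_m(𝔸)`-invariant (`|ψ_N| = 1`)
  set F : GL (Fin m) 𝔸 → ℂ := fun x => W (glCorner 𝔸 (Nat.le_succ m) x) * conj (W' x) with hF
  have hFm : Measurable F := hWιm.mul (Complex.continuous_conj.measurable.comp hW'c.measurable)
  have hFu : ∀ u ∈ adelicColRange m K 1 (m - 1), ∀ x : GL (Fin m) 𝔸, F (u * x) = F x := fun u hu x => by
    simp only [hF]
    rw [hWu u hu x, hW'u u hu x, map_mul, mul_mul_mul_comm, Complex.mul_conj, Circle.normSq_coe,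
      Complex.ofReal_one, one_mul]
  have hint₅ : Integrable (fun x => F x * D x * ((β' x).toReal : ℂ)) ν :=
    (hdom (Complex.continuous_conj.measurable.comp hW'c.measurable) hW'b).congr
      (Eventually.of_forall fun x => by simp only [hF, Function.comp_apply]; ring)
  have hB5 := (h5 hFm hFu (s - 1 / 2) hβ'.measurable hβ'.coveringSum_eq hint₅).2
  -- assembly
  have e1 : ∀ g : GL (Fin m) 𝔸, Φ (glCorner 𝔸 (Nat.le_succ m) g) * Φ' g *
      ((((glAbsDet m K g : ℝ≥0ˣ) : ℝ≥0) : ℝ) : ℂ) ^ (s - 1 / 2) * ((β g).toReal : ℂ) =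
        Φ (glCorner 𝔸 (Nat.le_succ m) g) * Θ g * ((β g).toReal : ℂ) := fun g => by
    rw [show ((((glAbsDet m K g : ℝ≥0ˣ) : ℝ≥0) : ℝ) : ℂ) ^ (s - 1 / 2) = D g from rfl]
    simp only [hΘ]; ring
  have e7 : ∀ p, F (torusPoint m K p) * torusWeightC m K (s - 1 / 2) p.1 = torusPairIntegrandC m K
      (fun g => W (glCorner 𝔸 (Nat.le_succ m) g)) (fun g => conj (W' g)) (fun _ => (1 : ℝ)) (s - 1 / 2) p :=
    fun p => by simp only [hF, torusPairIntegrandC, Complex.ofReal_one, mul_one]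
  calc jpssIntegral (Nat.lt_succ_self m) μ' φ φ' s
      = (C₂ : ℂ) * ∫ x, Φ (glCorner 𝔸 (Nat.le_succ m) x) * Θ x * ((β x).toReal : ℂ) ∂ν := by
        rw [hB2]; congr 1; exact integral_congr_ae (Eventually.of_forall e1)
    _ = (C₂ : ℂ) * ∫ x, W (glCorner 𝔸 (Nat.le_succ m) x) * Θ x * ((β' x).toReal : ℂ) ∂ν := by rw [hB3]
    _ = (C₂ : ℂ) * ∫ x, H x * Φ' x * ((β' x).toReal : ℂ) ∂ν := by
        rw [integral_congr_ae (Eventually.of_forall fun x => show _ = H x * Φ' x * ((β' x).toReal : ℂ) by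
          simp only [hΘ, hH]; ring)]
    _ = (C₂ : ℂ) * ∫ x, H x * conj (W' x) * ((β' x).toReal : ℂ) ∂ν := by rw [hB4]
    _ = (C₂ : ℂ) * ∫ x, F x * D x * ((β' x).toReal : ℂ) ∂ν := by
        rw [integral_congr_ae (Eventually.of_forall fun x => show _ = F x * D x * ((β' x).toReal : ℂ) by
          simp only [hH, hF]; ring)]
    _ = (C₂ : ℂ) * ((C₅ : ℂ) * ∫ p, F (torusPoint m K p) * torusWeightC m K (s - 1 / 2) p.1 ∂(νA.prod νK)) := by
        rw [hB5]
    _ = ((C₂ * C₅ : ℝ) : ℂ) * ∫ p, torusPairIntegrandC m K (fun g => W (glCorner 𝔸 (Nat.le_succ m) g))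
          (fun g => conj (W' g)) (fun _ => (1 : ℝ)) (s - 1 / 2) p ∂(νA.prod νK) := by
        rw [integral_congr_ae (Eventually.of_forall e7), Complex.ofReal_mul, mul_assoc]

end Main

/-- **STUB (W-G) — the GLOBAL corner theorem: the `GL_{m+1} × GL_m` integral unfolded to the torus**
(Cogdell (2004), §2.2–2.3, Thm. 2.1 (Eulerian clause); JPSS (1983), §2): the registered signature, by
`jpssIntegral_eq_mul_integral_torusPairIntegrandC`. [cite: CogdellAnalyticTheory2004, §2.2–2.3 Thm. 2.1] -/
theorem stub_corner_global :
    ∀ {m : ℕ} {K : Type} [Field K] [NumberField K]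
      [MeasurableSpace (AdeleRing (𝓞 K) K)] [BorelSpace (AdeleRing (𝓞 K) K)] (_hm : 0 < m)
      (μ' : Measure (AdelicGroupData.gl m K).automorphicQuotient) [(AdelicGroupData.gl m K).IsAutomorphicMeasure μ']
      (νA : Measure (Fin m → ideleGroup K)) [IsHaarMeasure νA]
      (νK : Measure ↥(maximalCompactAdelic m K)) [IsHaarMeasure νK],
      ∃ C : ℝ, 0 < C ∧
        ∀ {φ : (AdelicGroupData.gl (m + 1) K).automorphicQuotient → ℂ},
          IsCuspFormGL (m + 1) K (isCompact_glFiniteIntegralLevel_holds (m + 1) K)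
            (invQuot (AdelicGroupData.gl (m + 1) K) φ) →
        ∀ {φ' : (AdelicGroupData.gl m K).automorphicQuotient → ℂ},
          IsCuspFormGL m K (isCompact_glFiniteIntegralLevel_holds m K) (invQuot (AdelicGroupData.gl m K) φ') →
        ∀ (s : ℂ),
          ∫⁻ p, ‖whittakerDepth 0 (invQuot (AdelicGroupData.gl (m + 1) K) φ)
                (glCorner (AdeleRing (𝓞 K) K) (Nat.le_succ m) (torusPoint m K p))‖ₑ *
              ENNReal.ofReal (torusWeight m K (s.re - 1 / 2) p.1) ∂(νA.prod νK) < ⊤ →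
          jpssIntegral (Nat.lt_succ_self m) μ' φ φ' s =
            (C : ℂ) * ∫ p, torusPairIntegrandC m K
              (fun g => whittakerDepth 0 (invQuot (AdelicGroupData.gl (m + 1) K) φ)
                (glCorner (AdeleRing (𝓞 K) K) (Nat.le_succ m) g))
              (fun g => conj (whittakerDepth 0 (fun x => conj (invQuot (AdelicGroupData.gl m K) φ' x)) g))
              (fun _ => (1 : ℝ)) (s - 1 / 2) p ∂(νA.prod νK) := by
  intro m K _ _ _ _ hm μ' _ νA _ νK _
  exact jpssIntegral_eq_mul_integral_torusPairIntegrandC hm μ' νA νK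

end Summit.Langlands.Langlands.Theorems.CornerGlobal

end
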